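import Summits.ResolutionOfSingularities.ResolutionOfSingularities.Theorems.EquisingularLiftEquisingularLiftNatResidueHypDefsE11
import Literature.AlgebraicGeometry.Motives.ProjBaseChangeAny
import HarnessLib

/-!
# EL♮(3) / EL♮(n), RUNG LC «large characteristic» — brick for (B3′)-shrink / (B4) / (B5)(c1): BASE CHANGE OF THE DESCENT WORD
# `ExceptionalFlatOver` ∧ `DescCentresSmoothOver` along `Spec E → Spec D`, and `DescDoorAt B k θ ↦ DescDoorAt B' k θ'` along `B → B'`

leafhand-res-equisingularlift-3 g0 (prover, 2026-08-31; one-generation line-first hand on stmt-ResolutionOfSingularities-20148 / -20038 /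
-15660, cell `pub/decomp-res`).  Sub-problem `ResolutionOfSingularities`, crux `EquisingularLiftNatThree` (`stmt-…-20148`; uniform in `n`, so
also `stmt-…-20038`), line W4.5(b), RUNG LC (idea-2 g32 `Cruxes/EquisingularLiftNatThree/LARGE-CHAR-RUNG-idea2.md` v1.6): the remaining weight
`hspread` of ✓ `LargeChar.elnatLargeChar_of_spread_of_engine` (…NatLargeCharRoof) is a B-side word «`s : CentreSeq ℙⁿ_B` with B-FLAT exceptionals
(✓ `CentreSeq.ExceptionalFlatOver`) and B-SMOOTH centres (✓ `DescCentresSmoothOver`) whose k-fibres are embedded resolution words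
(✓ `DescTransformOK`)» = ✓ `DescDoorAt B k θ n H ι` (…NatResidueHypDefsE11 :56), built by the spread (B3′) over `A[1/a]` and then read over the
FURTHER SHRUNKEN smooth base `B := A[1/(a a₀)]` of (B4) (✓ `LargeChar.exists_formallySmooth_away_of_charZero`, …NatLargeCharSmoothBase), resp. over
`A[1/(a b)]` at every shrinking step of the recursion (B3′)(s1)–(s5).  Each such passage is a BASE CHANGE of the word along a ring map
`B → B'` with `θ = θ' ∘ (B → B')`.  This file proves, DEF-FREE, that the word base-changes:

* `comap_exceptional_eq_comap_comapMap` — the exceptional ideal of the base-changed CHOSEN blow-up is the pull-back of the exceptional ideal: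
  `(ι^*C)·𝒪_{Bl_{ι^*C} X_E} = (C·𝒪_{Bl_C X})·𝒪` along `Bl(ι) : Bl_{ι^*C}(X_E) ⟶ Bl_C(X)` (Mathlib `IdealSheafData.comap_comp` + ✓ `blowup.comapMap_π`);
* `exceptionalFlatOver_comap_of_isPullback` — for ANY cartesian square `X_E = X ×_{Spec D} Spec E` (✓ `specOfAlgebra D E`) and ANY
  `s : CentreSeq X` with `s.ExceptionalFlatOver q`: `(s.comap ι).ExceptionalFlatOver q_E` (flatness is stable under base change; the stages are
  base changes by ✓ `CentreSeq.ExceptionalFlatOver.tail`, the exceptional subschemes by ✓ `isPullback_subschemeι_comap`);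
* `descCentresSmoothOver_comap_of_isPullback` — same square, `s.ExceptionalFlatOver q ∧ DescCentresSmoothOver s q ⇒ DescCentresSmoothOver (s.comap ι) q_E`
  (✓ `smooth_subschemeι_comap_comp` stage by stage);
* ★ `descDoorAt_of_comp_algebraMap` — **monotonicity of the point-wise door in the base**: for any `B`-algebra `B'` and any point
  `θ' : B' →+* k`, `DescDoorAt B k (θ' ∘ algebraMap B B') n H ι → DescDoorAt B' k θ' n H ι`.  Proof: base-change the word along
  `ℙⁿ_{B'} ⟶ ℙⁿ_B` (✓ `ProjBaseChangeRing.isPullback_projMap'`, any algebra) by the two lemmas above; a graded lift `φ'` of `θ'` composed with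
  `B[x] → B'[x]` is a graded lift of `θ' ∘ (B → B')` (✓ `ProjBaseChangeRing.mapGraded_apply`, `MvPolynomial.map_map`), its fibre square pastes
  (`IsPullback.paste_horiz`), `Proj.map` of the composite is the composite (Mathlib `Proj.map_comp`), and the induced sequence along a composite is
  the iterated induced sequence (✓ `CentreSeq.comap_comp`) — so the word's own `DescTransformOK` clause, called at the composite, is the clause wanted;
  `descDoorAt_of_ringHom` — the same with a ring map `g : B →+* B'` and `θ = θ'.comp g` (`g.toAlgebra`).

USE (RUNG LC only; nothing here is specific to `n = 3`): the (B3′)/(B5) recursion may shrink the base freely AFTER each clause is obtained, and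
(B4) may shrink to the smooth locus AFTER the word is built — the door at the coefficient point survives every such shrink.  Honest label:
bookkeeping, no mathematical content beyond «flat / smooth are stable under base change»; `hspread` itself (LC-SPREAD, LC-FIB, (B5) proper)
remains UNFUNDED; EL♮(3) NOT proved; EL♮ NOT proved; resolution of singularities in positive characteristic NOT proved; nothing of
[Hironaka2017] (a candidate under adjudication) is asserted or used.  [OURS · pure bookkeeping over ✓ Literature `BlowupSequencesBaseChange` /
✓ `ProjBaseChangeAny` · standard axioms · DEF-FREE · `--supports stmt-ResolutionOfSingularities-20148 --as helper`, counted 0 · AI-written,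
weaker than expert review.] [cite: StacksProject, Tag 056P (1) with Tag 0805] [cite: Liu2002, Prop. 3.1.9 and Ex. 3.1.10] (method; index only)
-/

set_option linter.dupNamespace false -- mandated namespace `Summit.<Summit>.<Problem>` of this single-conjunct summit

noncomputable section

open CategoryTheory CategoryTheory.Limits AlgebraicGeometry TopologicalSpace
open MvPolynomial
open Literature.AlgebraicGeometry.Resolution
open Literature.AlgebraicGeometry.Motives
open AlgebraicGeometry.Scheme.IdealSheafData

/-! ## Literature-level: the exceptional-flatness word base-changes -/

namespace Literature.AlgebraicGeometry.Resolution

universe u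

section ExceptionalBaseChange

variable {D : Type u} (E : Type u) [CommRing D] [CommRing E] [Algebra D E]

/-- **The exceptional ideal of the base-changed chosen blow-up is the pulled-back exceptional ideal**: for any morphism `ι : X_E ⟶ X`
and ideal sheaf `C` on `X`, `(ι^*C)·𝒪_{Bl_{ι^*C}(X_E)} = Bl(ι)^*(C·𝒪_{Bl_C(X)})`, because `Bl(ι) ≫ π_C = π_{ι^*C} ≫ ι`
(✓ `blowup.comapMap_π`) and pull-back of ideal sheaves is functorial (Mathlib `IdealSheafData.comap_comp`).
[cite: GortzWedhorn2020, Prop. 13.91 (1)] [folklore] -/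
theorem comap_exceptional_eq_comap_comapMap {X XE : Scheme.{u}} (C : X.IdealSheafData) (ι : XE ⟶ X) :
    (C.comap ι).comap (blowup.π (C.comap ι)) = (C.comap (blowup.π C)).comap (blowup.comapMap C ι) := by
  rw [← Scheme.IdealSheafData.comap_comp, ← Scheme.IdealSheafData.comap_comp, blowup.comapMap_π]

/-- **`ExceptionalFlatOver` is stable under base change**: if every exceptional divisor of the multiple blow-up `s` of the `D`-scheme
`q : X ⟶ Spec D` is flat over `Spec D`, then for ANY cartesian square `X_E = X ×_{Spec D} Spec E` (`HX : IsPullback ι q_E q (Spec E → Spec D)`)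
every exceptional divisor of the induced sequence `s.comap ι` of the `E`-scheme `q_E : X_E ⟶ Spec E` is flat over `Spec E`.  Step: the
blown-up square is again a base change of `Spec E → Spec D` (✓ `CentreSeq.ExceptionalFlatOver.tail`), the exceptional subscheme of the
base-changed blow-up is the base change of the exceptional subscheme (`comap_exceptional_eq_comap_comapMap` + ✓ `isPullback_subschemeι_comap`),
and flatness is stable under base change (Mathlib). [cite: StacksProject, Tag 056P (1) with Tag 0805] -/
theorem CentreSeq.exceptionalFlatOver_comap_of_isPullback :
    ∀ {X XE : Scheme.{u}} (s : CentreSeq X) (q : X ⟶ Spec (.of D)) (_ : s.ExceptionalFlatOver q)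
      {ι : XE ⟶ X} {sE : XE ⟶ Spec (.of E)} (_ : IsPullback ι sE q (specOfAlgebra D E)),
      (s.comap ι).ExceptionalFlatOver sE
  | _, _, .nil _, _, _, _, _, _ => by simp
  | X, XE, .cons C rest, q, hs, ι, sE, HX => by
    -- the blown-up square, again a base change of `Spec E → Spec D`
    obtain ⟨hrest, H1⟩ := CentreSeq.ExceptionalFlatOver.tail E hs HX
    haveI : Flat ((C.comap (blowup.π C)).subschemeι ≫ blowup.π C ≫ q) := hs.1
    -- the exceptional subscheme downstairs is the base change of the exceptional subscheme upstairs
    have hsq := isPullback_subschemeι_comap E (blowup.π C ≫ q) (C.comap (blowup.π C)) H1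
    have hflat : Flat (((C.comap (blowup.π C)).comap (blowup.comapMap C ι)).subschemeι ≫ blowup.π (C.comap ι) ≫ sE) :=
      MorphismProperty.IsStableUnderBaseChange.of_isPullback hsq ‹_›
    rw [CentreSeq.comap_cons, CentreSeq.exceptionalFlatOver_cons]
    refine ⟨?_, CentreSeq.exceptionalFlatOver_comap_of_isPullback rest (blowup.π C ≫ q) hrest H1⟩
    rw [comap_exceptional_eq_comap_comapMap]
    exact hflat

end ExceptionalBaseChange

end Literature.AlgebraicGeometry.Resolution

/-! ## Summits-level: the smooth-centres word and the point-wise door base-change -/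

namespace Summit.ResolutionOfSingularities.ResolutionOfSingularities.Cruxes.EquisingularLiftNat.Sections

section CentresBaseChange

variable {D : Type} (E : Type) [CommRing D] [CommRing E] [Algebra D E]

/-- **`DescCentresSmoothOver` is stable under base change** (given B-flat exceptionals, so that the induced sequence IS the base change stage by
stage): for any cartesian square `X_E = X ×_{Spec D} Spec E` and any `s : CentreSeq X` with `s.ExceptionalFlatOver q` and `DescCentresSmoothOver s q`,
the induced sequence has `DescCentresSmoothOver (s.comap ι) q_E`.  Step: ✓ `smooth_subschemeι_comap_comp` (the pulled-back centre is the base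
change of the centre; smoothness is stable under base change) and ✓ `CentreSeq.ExceptionalFlatOver.tail` (the next stage is again a base change).
[cite: StacksProject, Tag 056P (1) with Tag 0805] [OURS · bookkeeping] -/
theorem descCentresSmoothOver_comap_of_isPullback :
    ∀ {X XE : Scheme.{0}} (s : CentreSeq X) (q : X ⟶ Spec (.of D)) (_ : s.ExceptionalFlatOver q) (_ : DescCentresSmoothOver s q)
      {ι : XE ⟶ X} {sE : XE ⟶ Spec (.of E)} (_ : IsPullback ι sE q (specOfAlgebra D E)),
      DescCentresSmoothOver (s.comap ι) sE
  | _, _, .nil _, _, _, _, _, _, _ => by simp [DescCentresSmoothOver]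
  | X, XE, .cons C rest, q, hs, hsm, ι, sE, HX => by
    obtain ⟨hrest, H1⟩ := CentreSeq.ExceptionalFlatOver.tail E hs HX
    haveI : Smooth (C.subschemeι ≫ q) := hsm.1
    have h1 : Smooth ((C.comap ι).subschemeι ≫ sE) := smooth_subschemeι_comap_comp E q C HX
    rw [CentreSeq.comap_cons]
    exact ⟨h1, descCentresSmoothOver_comap_of_isPullback rest (blowup.π C ≫ q) hrest hsm.2 H1⟩

end CentresBaseChange

section DoorBaseChange

/-- ★ **`descDoorAt_of_comp_algebraMap` — the point-wise descent door is MONOTONE IN THE BASE**: for any `B`-algebra `B'` (e.g. a further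
localisation `A[1/a] → A[1/(a a₀)]` of RUNG LC (B4), or any shrink of the (B3′) recursion) and any point `θ' : B' →+* k`, a certificate over `B`
at the composite point `θ' ∘ (B → B')` yields a certificate over `B'` at `θ'`: base-change the word along `ℙⁿ_{B'} ⟶ ℙⁿ_B`
(✓ `ProjBaseChangeRing.isPullback_projMap'`; `exceptionalFlatOver_comap_of_isPullback`, `descCentresSmoothOver_comap_of_isPullback`), and read the
`DescTransformOK` clause of the given word at the composite graded lift `φ' ∘ (B[x] → B'[x])` of `θ' ∘ (B → B')`, whose fibre square is the pasted
one and whose induced sequence is `(s.comap _).comap (Proj.map φ')` (Mathlib `Proj.map_comp`, ✓ `CentreSeq.comap_comp`).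
[cite: Liu2002, Prop. 3.1.9 and Ex. 3.1.10] [OURS · L1 W4.5b · RUNG LC bookkeeping; EL♮(3) NOT proved] -/
theorem descDoorAt_of_comp_algebraMap (B B' : Type) [CommRing B] [CommRing B'] [Algebra B B'] (k : Type) [Field k]
    (θ' : B' →+* k) (n : ℕ) (H : AlgebraicGeometry.Scheme.{0}) (ι : H ⟶ (Literature.AlgebraicGeometry.Motives.projectiveSpace n k).left)
    (hD : DescDoorAt B k (θ'.comp (algebraMap B B')) n H ι) : DescDoorAt B' k θ' n H ι := by
  letI := MvPolynomial.gradedAlgebra (σ := Fin (n + 1)) (R := B)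
  letI := MvPolynomial.gradedAlgebra (σ := Fin (n + 1)) (R := B')
  letI := MvPolynomial.gradedAlgebra (σ := Fin (n + 1)) (R := k)
  classical
  obtain ⟨s, hEF, hCS, hTOK⟩ := hD
  -- the structure morphisms of `ℙⁿ_B`, `ℙⁿ_{B'}`
  set qB : Proj (homogeneousSubmodule (Fin (n + 1)) B) ⟶ Spec (.of B) :=
    Proj.toSpecZero (homogeneousSubmodule (Fin (n + 1)) B) ≫
      Spec.map (CommRingCat.ofHom (algebraMap B (homogeneousSubmodule (Fin (n + 1)) B 0))) with hqB
  set qB' : Proj (homogeneousSubmodule (Fin (n + 1)) B') ⟶ Spec (.of B') :=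
    Proj.toSpecZero (homogeneousSubmodule (Fin (n + 1)) B') ≫
      Spec.map (CommRingCat.ofHom (algebraMap B' (homogeneousSubmodule (Fin (n + 1)) B' 0))) with hqB'
  -- `G : ℙⁿ_{B'} ⟶ ℙⁿ_B`, the base change of `Spec B' → Spec B` (any algebra)
  set G : Proj (homogeneousSubmodule (Fin (n + 1)) B') ⟶ Proj (homogeneousSubmodule (Fin (n + 1)) B) :=
    Proj.map (ProjBaseChangeRing.mapGraded B B' (Fin (n + 1))) (ProjBaseChangeRing.irrelevant_le_map B B' (Fin (n + 1))) with hG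
  have HG : IsPullback G qB' qB (specOfAlgebra B B') := ProjBaseChangeRing.isPullback_projMap' B B'
  -- the base-changed word
  refine ⟨s.comap G, CentreSeq.exceptionalFlatOver_comap_of_isPullback B' s qB hEF HG,
    descCentresSmoothOver_comap_of_isPullback B' s qB hEF hCS HG, ?_⟩
  intro φ' hφ'' hφ' hsq'
  -- the composite graded lift of the composite point
  set ψ : homogeneousSubmodule (Fin (n + 1)) B →+*ᵍ homogeneousSubmodule (Fin (n + 1)) k :=
    φ'.comp (ProjBaseChangeRing.mapGraded B B' (Fin (n + 1))) with hψ
  have hψθ : ∀ t, ψ t = MvPolynomial.map (θ'.comp (algebraMap B B')) t := by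
    intro t
    show φ' (ProjBaseChangeRing.mapGraded B B' (Fin (n + 1)) t) = MvPolynomial.map (θ'.comp (algebraMap B B')) t
    rw [ProjBaseChangeRing.mapGraded_apply, hφ', MvPolynomial.map_map]
  have hψ' : HomogeneousIdeal.irrelevant (homogeneousSubmodule (Fin (n + 1)) k) ≤
      (HomogeneousIdeal.irrelevant (homogeneousSubmodule (Fin (n + 1)) B)).map ψ :=
    HomogeneousIdeal.irrelevant_le_map_comp (ProjBaseChangeRing.irrelevant_le_map B B' (Fin (n + 1))) hφ''
  have hcomp : (Proj.map ψ hψ' : (Literature.AlgebraicGeometry.Motives.projectiveSpace n k).left ⟶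
      Proj (homogeneousSubmodule (Fin (n + 1)) B)) = Proj.map φ' hφ'' ≫ G :=
    Proj.map_comp _ _ (ProjBaseChangeRing.irrelevant_le_map B B' (Fin (n + 1))) hφ''
  -- its fibre square is the pasted one
  have hsq : IsPullback (Proj.map ψ hψ' : (Literature.AlgebraicGeometry.Motives.projectiveSpace n k).left ⟶
        Proj (homogeneousSubmodule (Fin (n + 1)) B))
      (Proj.toSpecZero (homogeneousSubmodule (Fin (n + 1)) k) ≫
        Spec.map (CommRingCat.ofHom (algebraMap k (homogeneousSubmodule (Fin (n + 1)) k 0))))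
      qB (Spec.map (CommRingCat.ofHom (θ'.comp (algebraMap B B')))) := by
    have e : Spec.map (CommRingCat.ofHom (θ'.comp (algebraMap B B'))) =
        Spec.map (CommRingCat.ofHom θ') ≫ specOfAlgebra B B' := by
      rw [CommRingCat.ofHom_comp, Spec.map_comp]
    rw [hcomp, e]
    exact hsq'.paste_horiz HG
  -- the given word's clause at the composite, re-read along `CentreSeq.comap_comp`
  have hT := hTOK ψ hψ' hψθ hsq
  rw [hcomp, CentreSeq.comap_comp] at hT
  exact hT

/-- `descDoorAt_of_ringHom` — the same along a ring map `g : B →+* B'` with `θ = θ' ∘ g` (`Algebra B B' := g.toAlgebra`).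
[cite: Liu2002, Prop. 3.1.9 and Ex. 3.1.10] [OURS · L1 W4.5b · RUNG LC bookkeeping] -/
theorem descDoorAt_of_ringHom (B B' : Type) [CommRing B] [CommRing B'] (g : B →+* B') (k : Type) [Field k]
    (θ : B →+* k) (θ' : B' →+* k) (hθ : θ = θ'.comp g) (n : ℕ) (H : AlgebraicGeometry.Scheme.{0})
    (ι : H ⟶ (Literature.AlgebraicGeometry.Motives.projectiveSpace n k).left)
    (hD : DescDoorAt B k θ n H ι) : DescDoorAt B' k θ' n H ι := by
  letI : Algebra B B' := g.toAlgebra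
  subst hθ
  exact descDoorAt_of_comp_algebraMap B B' k θ' n H ι hD

end DoorBaseChange

end Summit.ResolutionOfSingularities.ResolutionOfSingularities.Cruxes.EquisingularLiftNat.Sections

end
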